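import Literature.Topology.FourManifolds.SurfaceGroupEpimorphismsStandard
import Literature.Topology.FourManifolds.SurfaceGroupHandleMoves
import Literature.Topology.FourManifolds.SurfaceGroupGenusOne
import Literature.GroupTheory.CombinatorialGroupTheory.QuadraticWordsEngine
import Literature.GroupTheory.CombinatorialGroupTheory.QuadraticWordsGathering
import HarnessLib

/-!
# Proof of the Grigorchuk–Kurchanov classification of epimorphisms `π₁(S_g) ↠ F_g`

Topic `Literature/Topology/FourManifolds`.  This file discharges the named fact
`GrigorchukKurchanov1990_stronglyEquivalent` of `SurfaceGroupEpimorphisms.lean`: any two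
epimorphisms of the genus-`g` orientable surface group onto the free group of rank `g` differ by
an automorphism of the surface group.

The proof is Zieschang's (Zieschang 1964; Zieschang–Vogt–Coldewey, LNM 835, §5.2 and E 5.4),
entirely algebraic:

1. (`SurfaceGroupEpimorphismsStandard`) By Nielsen's method in `F_g`, it suffices that every
   epimorphism `φ : S_g ↠ F_g` kills `γ(a₁), …, γ(a_g)` for some automorphism `γ` of `S_g`
   (`stronglyEquivalent_of_forall_exists_apply_a_eq_one`).
2. (`QuadraticWordsEngine`) The relator `Π = ∏ [aᵢ, bᵢ]`, an alternating quadratic word, maps to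
   `1` under `φ`; Zieschang's cancellation engine transforms `(Π, φ)` by transport moves
   (automorphisms of the free group on the symbols carrying a permutation of the letters of
   `Π` to a conjugate of `Π`) into a **terminal** pattern: the word dies after deleting the
   letters of the symbols of value `1` (`exists_terminal`).
3. (`QuadraticWordsForm`, `QuadraticWordsGathering`) The intersection form of `Π` is the
   standard symplectic form, nondegenerate, and nondegeneracy transports along the moves; in a
   terminal nondegenerate quadratic word the handles can be gathered into commutator blocks
   `∏ [x_{qᵢ}, x_{zᵢ}]` with every `zᵢ` of value `1` (`exists_blocks_of_terminal`).
4. (here) Relabelling the blocks to `Π` by a signed permutation of the symbols and composing,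
   we get an automorphism `Φ` of `F(a, b)` with `Φ(Π)` conjugate to `Π` under which `φ` kills
   the images of all `bᵢ`; `Φ` induces an automorphism of `S_g` (`autOfFreeAut`), and a cut
   swap `aᵢ ↦ aᵢbᵢaᵢ⁻¹` turns "kills the `bᵢ`" into "kills the `aᵢ`".

## References

* R. I. Grigorchuk, P. F. Kurchanov, *Classification of epimorphisms from fundamental groups of
  surfaces onto free groups*, Mat. Zametki 48 (1990); Math. Notes 48 (1990). [GrigorchukKurchanov1990]
* H. Zieschang, *Alternierende Produkte in freien Gruppen*, Abh. Math. Sem. Hamburg 27 (1964).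
* H. Zieschang, E. Vogt, H.-D. Coldewey, *Surfaces and Planar Discontinuous Groups*, LNM 835,
  Springer 1980, §3.2, §3.6, §5.2 (Thm. 5.2.8, Cor. 5.2.13), E 5.4. [ZieschangVogtColdewey1980]
-/

namespace Literature.Topology.FourManifolds

open Literature.GroupTheory.CombinatorialGroupTheory List

namespace SurfaceGroup

variable {g : ℕ}

/-! ### The relator as a word -/

/-- The product of the block words over a list of handles is the product of the commutators.
[folklore] -/
private theorem mk_flatMap_stdBlock (l : List (Fin g)) :
    FreeGroup.mk (l.flatMap fun i =>
      [(((i, false) : surfaceGen g), true), ((i, true), true), ((i, false), false), ((i, true), false)]) =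
      (l.map fun i => genA i * genB i * (genA i)⁻¹ * (genB i)⁻¹).prod := by
  induction l with
  | nil => rfl
  | cons i l ih =>
    rw [flatMap_cons, mk_append, ih, map_cons, prod_cons]
    congr 1

/-- **The surface relator is the standard surface word.** [folklore] -/
theorem mk_surfaceWordStd (g : ℕ) : FreeGroup.mk (surfaceWordStd g) = surfaceRelator g :=
  mk_flatMap_stdBlock (List.finRange g)

/-- The values of the generators under `φ ∘ mk` are `φ` on the generators, on every element.
[folklore] -/
theorem lift_of_comp_mk (φ : SurfaceGroup g →* FreeGroup (Fin g)) (y : FreeGroup (surfaceGen g)) :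
    FreeGroup.lift (fun x => φ (PresentedGroup.of x)) y =
      φ (PresentedGroup.mk ({surfaceRelator g} : Set (FreeGroup (surfaceGen g))) y) := by
  change _ = (φ.comp (PresentedGroup.mk _)) y
  congr 1
  exact FreeGroup.ext_hom _ _ fun x => by simp [PresentedGroup.of]

/-! ### Automorphisms of `S_g` from automorphisms of the free group -/

/-- The endomorphism of `S_g` induced by an endomorphism `Φ` of `F(a, b)` with `Φ(Π)` conjugate
to `Π`. [folklore] -/
def endOfFreeHom (Φ : FreeGroup (surfaceGen g) →* FreeGroup (surfaceGen g)) (d : FreeGroup (surfaceGen g))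
    (h : Φ (surfaceRelator g) = d * surfaceRelator g * d⁻¹) : SurfaceGroup g →* SurfaceGroup g :=
  PresentedGroup.toGroup
    (f := fun x => PresentedGroup.mk ({surfaceRelator g} : Set (FreeGroup (surfaceGen g))) (Φ (FreeGroup.of x)))
    (by
      intro r hr
      rw [Set.mem_singleton_iff] at hr
      subst hr
      have e : (FreeGroup.lift fun x =>
          PresentedGroup.mk ({surfaceRelator g} : Set (FreeGroup (surfaceGen g))) (Φ (FreeGroup.of x))) =
          (PresentedGroup.mk _).comp Φ :=
        FreeGroup.ext_hom _ _ fun x => by simp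
      rw [e, MonoidHom.comp_apply, h, map_mul, map_mul, map_inv, mk_surfaceRelator, mul_one,
        mul_inv_cancel])

/-- `endOfFreeHom Φ` is `Φ` on representatives. [folklore] -/
theorem endOfFreeHom_mk (Φ : FreeGroup (surfaceGen g) →* FreeGroup (surfaceGen g)) (d : FreeGroup (surfaceGen g))
    (h : Φ (surfaceRelator g) = d * surfaceRelator g * d⁻¹) (y : FreeGroup (surfaceGen g)) :
    endOfFreeHom Φ d h (PresentedGroup.mk _ y) = PresentedGroup.mk _ (Φ y) := by
  change ((endOfFreeHom Φ d h).comp (PresentedGroup.mk _)) y = ((PresentedGroup.mk _).comp Φ) y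
  congr 1
  exact FreeGroup.ext_hom _ _ fun x => by
    change endOfFreeHom Φ d h (PresentedGroup.of x) = PresentedGroup.mk _ (Φ (FreeGroup.of x))
    unfold endOfFreeHom
    exact PresentedGroup.toGroup.of _

/-- **The automorphism of `S_g` induced by an automorphism `Φ` of `F(a, b)` with `Φ(Π)`
conjugate to `Π`.** [folklore] -/
noncomputable def autOfFreeAut (Φ : MulAut (FreeGroup (surfaceGen g))) (d : FreeGroup (surfaceGen g))
    (h : Φ (surfaceRelator g) = d * surfaceRelator g * d⁻¹) : SurfaceGroup g ≃* SurfaceGroup g :=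
  have h' : Φ⁻¹.toMonoidHom (surfaceRelator g) = (Φ⁻¹ d)⁻¹ * surfaceRelator g * (Φ⁻¹ d)⁻¹⁻¹ := by
    have := congrArg (Φ⁻¹ : MulAut (FreeGroup (surfaceGen g))) h
    rw [MulAut.inv_apply_self, map_mul, map_mul, map_inv] at this
    rw [inv_inv, MulEquiv.coe_toMonoidHom]
    conv_rhs => rw [this]
    group
  MonoidHom.toMulEquiv (endOfFreeHom Φ.toMonoidHom d h) (endOfFreeHom Φ⁻¹.toMonoidHom _ h')
    (PresentedGroup.ext fun x => by
      simp only [MonoidHom.coe_comp, Function.comp_apply, MonoidHom.id_apply, PresentedGroup.of,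
        endOfFreeHom_mk, MulEquiv.coe_toMonoidHom, MulAut.inv_apply_self])
    (PresentedGroup.ext fun x => by
      simp only [MonoidHom.coe_comp, Function.comp_apply, MonoidHom.id_apply, PresentedGroup.of,
        endOfFreeHom_mk, MulEquiv.coe_toMonoidHom, MulAut.apply_inv_self])

/-- `autOfFreeAut Φ` is `Φ` on representatives. [folklore] -/
theorem autOfFreeAut_mk (Φ : MulAut (FreeGroup (surfaceGen g))) (d : FreeGroup (surfaceGen g))
    (h : Φ (surfaceRelator g) = d * surfaceRelator g * d⁻¹) (y : FreeGroup (surfaceGen g)) :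
    autOfFreeAut Φ d h (PresentedGroup.mk _ y) = PresentedGroup.mk _ (Φ y) :=
  endOfFreeHom_mk _ d h y

/-! ### Signed relabellings of the free group -/

/-- The signed relabelling `xᵢ ↦ x_{π i}^{(ε i)}` of a free group along a bijection `π` and
signs `ε`, an automorphism. [folklore] -/
noncomputable def signedRelabel {ι : Type*} [DecidableEq ι] (π : ι ≃ ι) (ε : ι → Bool) : MulAut (FreeGroup ι) :=
  MonoidHom.toMulEquiv (FreeGroup.lift fun x => sgen (π x) (ε x))
    (FreeGroup.lift fun y => sgen (π.symm y) (ε (π.symm y)))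
    (FreeGroup.ext_hom _ _ fun x => by
      simp only [MonoidHom.coe_comp, Function.comp_apply, FreeGroup.lift_apply_of, MonoidHom.id_apply]
      cases hx : ε x
      · rw [sgen_false, map_inv, FreeGroup.lift_apply_of, Equiv.symm_apply_apply, hx, sgen_false, inv_inv]
      · rw [sgen_true, FreeGroup.lift_apply_of, Equiv.symm_apply_apply, hx, sgen_true])
    (FreeGroup.ext_hom _ _ fun y => by
      simp only [MonoidHom.coe_comp, Function.comp_apply, FreeGroup.lift_apply_of, MonoidHom.id_apply]
      cases hy : ε (π.symm y)
      · rw [sgen_false, map_inv, FreeGroup.lift_apply_of, Equiv.apply_symm_apply, hy, sgen_false, inv_inv]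
      · rw [sgen_true, FreeGroup.lift_apply_of, Equiv.apply_symm_apply, hy, sgen_true])

/-- `signedRelabel π ε` on a generator. [folklore] -/
theorem signedRelabel_of {ι : Type*} [DecidableEq ι] (π : ι ≃ ι) (ε : ι → Bool) (x : ι) :
    signedRelabel π ε (FreeGroup.of x) = sgen (π x) (ε x) := by
  simp [signedRelabel]

/-- `signedRelabel π ε` on a word: letters are relabelled `(x, t) ↦ (π x, t ↔ ε x)`. [folklore] -/
theorem signedRelabel_mk {ι : Type*} [DecidableEq ι] (π : ι ≃ ι) (ε : ι → Bool) (L : List (ι × Bool)) :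
    signedRelabel π ε (FreeGroup.mk L) =
      FreeGroup.mk (L.map fun x => (π x.1, bif x.2 then ε x.1 else !ε x.1)) := by
  induction L with
  | nil => exact map_one _
  | cons x L ih =>
    rw [mk_cons_eq_sgen_mul, map_mul, ih, map_cons, mk_cons_eq_sgen_mul]
    congr 1
    obtain ⟨i, _ | _⟩ := x
    · rw [sgen_false, map_inv, signedRelabel_of, cond_false, sgen_not]
    · rw [sgen_true, signedRelabel_of, cond_true]

/-! ### From blocks to the relator -/

/-- A list is the map of its entries over `finRange`. [folklore] -/
private theorem eq_map_finRange_get {α : Type*} (bs : List α) (hlen : bs.length = g) :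
    bs = (List.finRange g).map fun i => bs.get (i.cast hlen.symm) := by
  subst hlen
  simp only [Fin.cast_refl, id_eq]
  rw [← List.ofFn_eq_map, List.ofFn_get]

/-! ### The main step: every `φ : S_g → F_g` kills the `bᵢ` up to an automorphism -/

/-- **Zieschang's theorem** (ZVC E 5.4 with Cor. 5.2.13, in the form needed): for every
homomorphism `φ : S_g → F_g` there is an automorphism `γ` of `S_g` with `φ (γ bᵢ) = 1` for all
`i`. [cite: ZieschangVogtColdewey1980, E 5.4, 5.2.13] -/
theorem exists_mulEquiv_forall_apply_b_eq_one (φ : SurfaceGroup g →* FreeGroup (Fin g)) :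
    ∃ γ : SurfaceGroup g ≃* SurfaceGroup g, ∀ i, φ (γ (b i)) = 1 := by
  classical
  set X₀ : surfaceGen g → FreeGroup (Fin g) := fun x => φ (PresentedGroup.of x) with hX₀
  have hX₀rel : FreeGroup.lift X₀ (FreeGroup.mk (surfaceWordStd g)) = 1 := by
    rw [hX₀, lift_of_comp_mk, mk_surfaceWordStd, mk_surfaceRelator, map_one]
  -- Zieschang's engine: a terminal pattern
  obtain ⟨w, θ, c, hperm, hcert, hZ⟩ :=
    exists_terminal (surfaceWordStd g) (isQuadratic_surfaceWordStd g) X₀ hX₀rel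
  have hq : IsQuadratic w := (isQuadratic_surfaceWordStd g).perm hperm.symm
  have hN : Nondeg w :=
    (nondeg_surfaceWordStd g).transport (isQuadratic_surfaceWordStd g).isBalanced θ c hcert
  -- the endgame: gathering handles
  obtain ⟨bs, Θ, c', hpermB, hcertB, hvals⟩ :=
    exists_blocks_of_terminal (fun i => FreeGroup.lift X₀ (θ (FreeGroup.of i))) hq hN hZ
  -- the blocks enumerate the handles
  have hlen : bs.length = g := by
    have h1 := (hpermB.trans hperm).length_eq
    rw [length_blocksWord, length_surfaceWordStd] at h1
    omega
  set B : Fin g → Block (surfaceGen g) := fun i => bs.get (i.cast hlen.symm) with hB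
  have hbs : bs = (List.finRange g).map B := eq_map_finRange_get bs hlen
  have hBmem : ∀ i, B i ∈ bs := fun i => List.get_mem _ _
  have hbw : blocksWord bs = (List.finRange g).flatMap fun i => (B i).word := by
    conv_lhs => rw [hbs]
    rw [blocksWord, flatMap_map]
  -- the symbols of the blocks are pairwise distinct
  have hnodup : ((List.finRange g).flatMap fun i => (B i).word).Nodup :=
    hbw ▸ (hpermB.trans hperm).nodup_iff.2 (nodup_surfaceWordStd g)
  have hnd : ∀ i, (B i).word.Nodup := fun i => (nodup_flatMap.1 hnodup).1 i (mem_finRange i)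
  have hpair : ∀ i j : Fin g, i ≠ j → Disjoint (B i).word (B j).word := by
    intro i j hij
    have hP := (nodup_flatMap.1 hnodup).2
    obtain ⟨l₁, l₂, hl⟩ := append_of_mem (mem_finRange i)
    rw [hl, pairwise_append, pairwise_cons] at hP
    have hj : j ∈ l₁ ++ i :: l₂ := hl ▸ mem_finRange j
    rcases mem_append.1 hj with hj | hj
    · exact (hP.2.2 j hj i mem_cons_self).symm
    · rcases mem_cons.1 hj with rfl | hj
      · exact absurd rfl hij
      · exact hP.2.1.1 j hj
  let π₀ : surfaceGen g → surfaceGen g := fun x => bif x.2 then (B x.1).z else (B x.1).q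
  let ε : surfaceGen g → Bool := fun x => bif x.2 then (B x.1).σ else (B x.1).s
  have hsym : ∀ (x : surfaceGen g) (t : Bool), (π₀ x, t) ∈ (B x.1).word := by
    rintro ⟨i, _ | _⟩ t
    · rcases Bool.eq_false_or_eq_true t with rfl | rfl <;>
        rcases Bool.eq_false_or_eq_true (B i).s with h | h <;> simp [π₀, Block.word, h]
    · rcases Bool.eq_false_or_eq_true t with rfl | rfl <;>
        rcases Bool.eq_false_or_eq_true (B i).σ with h | h <;> simp [π₀, Block.word, h]
  have hπ₀ : Function.Injective π₀ := by
    rintro ⟨i, t⟩ ⟨j, u⟩ hxy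
    change π₀ (i, t) = π₀ (j, u) at hxy
    by_cases hij : i = j
    · subst hij
      by_contra hne
      have htu : t ≠ u := fun h => hne (by rw [h])
      have hqz : (B i).q = (B i).z := by
        cases t <;> cases u
        · exact absurd rfl htu
        · simpa [π₀] using hxy
        · simpa [π₀] using hxy.symm
        · exact absurd rfl htu
      have h := hnd i
      simp only [Block.word, hqz, nodup_cons, mem_cons, not_mem_nil, or_false, Prod.mk.injEq,
        true_and, not_or] at h
      obtain ⟨⟨h1, -, h3⟩, -⟩ := h
      revert h1 h3
      cases (B i).s <;> cases (B i).σ <;> simp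
    · exact (hpair i j hij (hsym (i, t) true) (hxy ▸ hsym (j, u) true)).elim
  let π : surfaceGen g ≃ surfaceGen g := Equiv.ofBijective π₀ (Finite.injective_iff_bijective.1 hπ₀)
  -- the relabelling carries the relator to the block word
  have hρrel : signedRelabel π ε (surfaceRelator g) = FreeGroup.mk (blocksWord bs) := by
    rw [← mk_surfaceWordStd, signedRelabel_mk, hbw, surfaceWordStd, map_flatMap]
    congr 1
  -- the total automorphism of the free group and the induced automorphism of `S_g`
  let Φ : MulAut (FreeGroup (surfaceGen g)) := θ * Θ * signedRelabel π ε
  have hΦ : Φ (surfaceRelator g) = (θ c' * c) * surfaceRelator g * (θ c' * c)⁻¹ := by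
    simp only [Φ, MulAut.mul_apply, hρrel, hcertB, map_mul, map_inv, hcert, mk_surfaceWordStd]
    group
  refine ⟨autOfFreeAut Φ _ hΦ, fun i => ?_⟩
  rw [b_def]
  change φ (autOfFreeAut Φ _ hΦ (PresentedGroup.mk _ (FreeGroup.of (i, true)))) = 1
  rw [autOfFreeAut_mk, ← lift_of_comp_mk]
  change FreeGroup.lift X₀ (θ (Θ (signedRelabel π ε (FreeGroup.of (i, true))))) = 1
  rw [lift_mulAut_apply X₀ θ, signedRelabel_of]
  have hz := hvals _ (hBmem i)
  have hπi : π (i, true) = (B i).z := rfl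
  have hεi : ε (i, true) = (B i).σ := rfl
  rw [hπi, hεi]
  cases (B i).σ
  · rw [sgen_false, map_inv, map_inv, hz, inv_one]
  · rw [sgen_true, hz]

/-- **Every epimorphism — indeed every homomorphism — `φ : S_g → F_g` kills `γ(a₁), …, γ(a_g)`
for some automorphism `γ` of `S_g`** (cut swap `aᵢ ↦ aᵢbᵢaᵢ⁻¹` after the previous theorem).
[cite: ZieschangVogtColdewey1980, E 5.4, 5.2.13] -/
theorem exists_mulEquiv_forall_apply_a_eq_one (φ : SurfaceGroup g →* FreeGroup (Fin g)) :
    ∃ γ : SurfaceGroup g ≃* SurfaceGroup g, ∀ i, φ (γ (a i)) = 1 := by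
  obtain ⟨γ, hγ⟩ := exists_mulEquiv_forall_apply_b_eq_one φ
  refine ⟨(cutSwapEquiv fun _ => true).trans γ, fun i => ?_⟩
  rw [MulEquiv.trans_apply, cutSwapEquiv_a, if_pos rfl, map_mul, map_mul, map_inv, map_mul, map_mul,
    map_inv, hγ i, mul_one, mul_inv_cancel]

end SurfaceGroup

/-- **Grigorchuk–Kurchanov (1990), orientable case, rank `g`: any two epimorphisms
`S_g ↠ F_g` are strongly equivalent** — discharge of the named fact
`GrigorchukKurchanov1990_stronglyEquivalent`, by Zieschang's algebraic proof (Zieschang–Vogt–Coldewey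
1980, §5.2, Thm. 5.2.8, Cor. 5.2.13 and E 5.4, formalised in `QuadraticWords*` and above).
[cite: GrigorchukKurchanov1990, main theorem (orientable case, r = g)] -/
theorem GrigorchukKurchanov1990_stronglyEquivalent_holds : GrigorchukKurchanov1990_stronglyEquivalent :=
  SurfaceGroup.stronglyEquivalent_of_forall_exists_apply_a_eq_one fun _ φ _ =>
    SurfaceGroup.exists_mulEquiv_forall_apply_a_eq_one φ

end Literature.Topology.FourManifolds
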